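import Literature.Barriers.FinalStateConjecture.KleinGordonRadialHorizon
import Literature.Analysis.ODE.ComplexSecondOrder
import Mathlib.Analysis.SpecialFunctions.Pow.Deriv
import Mathlib.Analysis.SpecialFunctions.Sqrt
import HarnessLib

/-!
# The radial Klein–Gordon equation on Kerr in Liouville normal form: the coefficient
# `Q = (V − d²/4)/Δ²`, its asymptotics, the horizon phase, and the passage from the ingoing chart

Topic `Literature/Barriers/FinalStateConjecture` (namespace `Literature.Barriers.FinalStateConjecture`).
Shlapentokh-Rothman's radial equation (CMP 329 (2014), §2 (2.2)) `Δ (Δ R')' − V R = 0`,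
`V = −(r² + a²)²ω² + 4Mamrω − a²m² + Δ(Λ + a²ω² + σ r²)` (`σ = μ²`), becomes, for `y = √Δ R`
(`r > r₊`), the normal form `y'' = Q y` with

`Q = (V − d²/4)/Δ²`, `d = r₊ − r₋`  (since `Δ − (Δ')²/4 = a² − M² = −d²/4`),

and the horizon-regular solutions of `KleinGordonRadialHorizon.lean` (power series `u` in the
ingoing chart, `Δu'' + (Δ' − 2iK)u' + W u = 0`, `K = 2Mωr − am`,
`W = ω²(r² + 2Mr) − 2iωM − Λ − σr²`) correspond to `y = G u` with the **horizon phase**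
`G = √Δ · Φ`, `Φ = exp(i((β/d) log(r − r₊) − (β₋/d) log(r − r₋)))`, `β = am − 2Mωr₊`,
`β₋ = am − 2Mωr₋` (`= √Δ e^{−i(ω(t̄ − r) − mφ̄)}` up to a constant phase, in the notation of
SR §1.2.1). Everything is proved:

* `radPot`, `radW`, `radK`, `radQ` and the algebra `V + K² = −Δ(W + 2iMω)` (`radPot_add_sq_radK`);
* the **separated form** `Q = ω² h₀ + ω h₁ + Λ h₂ + σ h₃ + h₄` (`radQ_eq_sum`, coefficient functions
  `radH i` continuous on `(r₊, ∞)`, monomials `radMon i` entire) — the input format of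
  `Literature/Analysis/ODE/ParametricSecondOrder.lean`;
* the **asymptotics**: `Q = (σ − ω²) + N/Δ²` with an explicit cubic `N` (`radQ_eq_add`), whence
  `‖Q(r) − (σ − ω²)‖ ≤ B (1 + r₊)³/(r − r₊)` for `r ≥ r₊ + 1` (`norm_radQ_sub_le`) and the region
  where `re Q ≥ γ²` (`re_radQ_ge`) — the input of `Literature/Analysis/ODE/RecessiveSolution.lean`;
* the phase: `Φ' = −(iK/Δ) Φ`, `G' = G₁ = G (Δ'/(2Δ) − iK/Δ)` (`hasDerivAt_radPhase`,
  `hasDerivAt_radG`), `‖Φ‖ = 1` for real `ω`;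
* the **conversion** (`hasDerivAt_liouville`): if `u` satisfies the ingoing equation at `r > r₊`
  then `y = G u` satisfies `y'' = Q y` there (with `y' = G₁ u + G u'`).

## References
* Y. Shlapentokh-Rothman, Comm. Math. Phys. 329 (2014) 859–891, §1.2.1, §2 (2.2)–(2.4), App. C.
  Key `ShlapentokhRothman2014KleinGordon`.
-/

noncomputable section

open Set Filter Metric
open scoped Topology ComplexConjugate

namespace Literature.Barriers.FinalStateConjecture

open Literature.Geometry.Lorentzian Literature.Analysis.ODE

/-! ### The potentials -/

section Potentials

variable (M a : ℝ) (m : ℤ)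

/-- The radial potential `V(r; ω, Λ, σ) = −(r² + a²)²ω² + 4Mamrω − a²m² + Δ(Λ + a²ω² + σr²)`
of SR §2 (2.2), with complex `σ` in place of `μ²`. [cite: ShlapentokhRothman2014KleinGordon, §2 (2.2)] -/
def radPot (p : ℂ × ℂ × ℂ) (r : ℝ) : ℂ :=
  -(((r ^ 2 + a ^ 2) ^ 2 : ℝ) : ℂ) * p.1 ^ 2 + ((4 * M * a * m * r : ℝ) : ℂ) * p.1 - ((a ^ 2 * (m : ℝ) ^ 2 : ℝ) : ℂ) +
    ((Kerr.delta M a r : ℝ) : ℂ) * (p.2.1 + ((a ^ 2 : ℝ) : ℂ) * p.1 ^ 2 + p.2.2 * ((r ^ 2 : ℝ) : ℂ))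

/-- The zeroth-order coefficient `W = ω²(r² + 2Mr) − 2iωM − Λ − σr²` of the ingoing equation.
[cite: ShlapentokhRothman2014KleinGordon, §2 (2.3)] -/
def radW (p : ℂ × ℂ × ℂ) (r : ℝ) : ℂ :=
  p.1 ^ 2 * ((r ^ 2 + 2 * M * r : ℝ) : ℂ) - 2 * Complex.I * p.1 * M - p.2.1 - p.2.2 * ((r ^ 2 : ℝ) : ℂ)

/-- `K = 2Mωr − am` (so that the ingoing first-order coefficient is `Δ' − 2iK`).
[cite: ShlapentokhRothman2014KleinGordon, §2 (2.3)] -/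
def radK (w : ℂ) (r : ℝ) : ℂ := 2 * M * w * r - (a * m : ℝ)

/-- **The Liouville coefficient** `Q = (V − d²/4)/Δ²` of the normal form `y'' = Q y`, `y = √Δ R`.
[cite: ShlapentokhRothman2014KleinGordon, §2 (2.2)] -/
def radQ (p : ℂ × ℂ × ℂ) (r : ℝ) : ℂ :=
  (radPot M a m p r - ((horD M a ^ 2 / 4 : ℝ) : ℂ)) / ((Kerr.delta M a r ^ 2 : ℝ) : ℂ)

variable {M a m}

/-- The key algebraic identity `V + K² = −Δ (W + 2iMω)`. [folklore] -/
theorem radPot_add_sq_radK (p : ℂ × ℂ × ℂ) (r : ℝ) :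
    radPot M a m p r + radK M a m p.1 r ^ 2 = -((Kerr.delta M a r : ℝ) : ℂ) * (radW M p r + 2 * Complex.I * M * p.1) := by
  simp only [radPot, radK, radW, Kerr.delta]
  push_cast
  ring

/-- `Δ − Δ'²/4 = −d²/4`, i.e. `(2(r − M))² = 4Δ + d²` (`d² = 4(M² − a²)`). [folklore] -/
theorem sq_deriv_delta (h : Kerr.IsSubextremal M a) (r : ℝ) :
    (2 * (r - M)) ^ 2 = 4 * Kerr.delta M a r + horD M a ^ 2 := by
  have hd : horD M a = 2 * Real.sqrt (M ^ 2 - a ^ 2) := by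
    unfold horD Kerr.rPlus Kerr.rMinus; ring
  have ha : a ^ 2 < M ^ 2 := by
    have := h; unfold Kerr.IsSubextremal at this
    exact sq_lt_sq' (abs_lt.1 this).1 (abs_lt.1 this).2
  have hs : Real.sqrt (M ^ 2 - a ^ 2) ^ 2 = M ^ 2 - a ^ 2 := Real.sq_sqrt (by linarith)
  rw [hd, Kerr.delta]
  nlinarith [hs]

end Potentials

/-! ### Separated form of `Q` -/

section Separated

variable (M a : ℝ) (m : ℤ)

/-- The (real) coefficient functions of the separated form
`Q = ω² h₀ + ω h₁ + Λ h₂ + σ h₃ + 1 · h₄`. [folklore] -/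
def radHR : Fin 5 → ℝ → ℝ :=
  ![fun r ↦ (-(r ^ 2 + a ^ 2) ^ 2 + Kerr.delta M a r * a ^ 2) / Kerr.delta M a r ^ 2,
    fun r ↦ 4 * M * a * m * r / Kerr.delta M a r ^ 2,
    fun r ↦ 1 / Kerr.delta M a r,
    fun r ↦ r ^ 2 / Kerr.delta M a r,
    fun r ↦ (-(a ^ 2 * (m : ℝ) ^ 2) - horD M a ^ 2 / 4) / Kerr.delta M a r ^ 2]

/-- The coefficient functions, as complex-valued functions. [folklore] -/
def radH (i : Fin 5) (r : ℝ) : ℂ := ((radHR M a m i r : ℝ) : ℂ)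

/-- The parameter monomials `(ω², ω, Λ, σ, 1)`. [folklore] -/
def radMon : Fin 5 → ℂ × ℂ × ℂ → ℂ :=
  ![fun p ↦ p.1 ^ 2, fun p ↦ p.1, fun p ↦ p.2.1, fun p ↦ p.2.2, fun _ ↦ 1]

variable {M a m}

/-- The parameter monomials are entire. [folklore] -/
theorem contDiff_radMon (i : Fin 5) : ContDiff ℂ ⊤ (radMon i) := by
  fin_cases i <;> simp [radMon] <;> fun_prop

/-- The real coefficient functions are continuous on `(r₊, ∞)`. [folklore] -/
theorem continuousOn_radHR (h : |a| ≤ M) (i : Fin 5) : ContinuousOn (radHR M a m i) (Ioi (Kerr.rPlus M a)) := by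
  have hΔ : ∀ r ∈ Ioi (Kerr.rPlus M a), Kerr.delta M a r ≠ 0 := fun r hr ↦ (Kerr.delta_pos h hr).ne'
  have hΔ2 : ∀ r ∈ Ioi (Kerr.rPlus M a), Kerr.delta M a r ^ 2 ≠ 0 := fun r hr ↦ pow_ne_zero 2 (hΔ r hr)
  have hΔc : Continuous fun r ↦ Kerr.delta M a r := by unfold Kerr.delta; fun_prop
  fin_cases i
  · exact ContinuousOn.div (by fun_prop) (by fun_prop) hΔ2
  · exact ContinuousOn.div (by fun_prop) (by fun_prop) hΔ2
  · exact ContinuousOn.div (by fun_prop) hΔc.continuousOn hΔ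
  · exact ContinuousOn.div (by fun_prop) hΔc.continuousOn hΔ
  · exact ContinuousOn.div (by fun_prop) (by fun_prop) hΔ2

/-- The coefficient functions are continuous on `(r₊, ∞)`. [folklore] -/
theorem continuousOn_radH (h : |a| ≤ M) (i : Fin 5) : ContinuousOn (radH M a m i) (Ioi (Kerr.rPlus M a)) :=
  Complex.continuous_ofReal.comp_continuousOn (continuousOn_radHR h i)

/-- **The separated form** `Q(p, r) = Σᵢ gᵢ(p) hᵢ(r)` on `(r₊, ∞)`. [folklore] -/
theorem radQ_eq_sum (h : |a| ≤ M) (p : ℂ × ℂ × ℂ) {r : ℝ} (hr : Kerr.rPlus M a < r) :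
    radQ M a m p r = ∑ i : Fin 5, radMon i p * radH M a m i r := by
  have hΔ : (Kerr.delta M a r : ℝ) ≠ 0 := (Kerr.delta_pos h hr).ne'
  have hΔc : ((Kerr.delta M a r : ℝ) : ℂ) ≠ 0 := by exact_mod_cast hΔ
  simp only [radQ, radPot, radMon, radH, radHR, Fin.sum_univ_five, Matrix.cons_val_zero, Matrix.cons_val_one,
    Matrix.cons_val_two, Matrix.cons_val_three, Matrix.cons_val_four, Matrix.head_cons, Matrix.tail_cons]
  push_cast
  field_simp
  ring

end Separated

/-! ### Asymptotics of `Q` -/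

section Asymptotics

variable (M a : ℝ) (m : ℤ)

/-- The cubic `N = V − d²/4 − (σ − ω²)Δ²`:
`N = 2M(σ − 2ω²) r³ + (Λ + (a² + 4M²)(ω² − σ)) r² + (4Mamω − 2MΛ + 4Ma²σ − 6Ma²ω²) r
 + (Λa² − a²m² − d²/4 + (ω² − σ)a⁴)`. [folklore] -/
def radN (p : ℂ × ℂ × ℂ) (r : ℝ) : ℂ :=
  2 * M * (p.2.2 - 2 * p.1 ^ 2) * ((r ^ 3 : ℝ) : ℂ) +
    (p.2.1 + ((a ^ 2 + 4 * M ^ 2 : ℝ) : ℂ) * (p.1 ^ 2 - p.2.2)) * ((r ^ 2 : ℝ) : ℂ) +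
    (((4 * M * a * m : ℝ) : ℂ) * p.1 - 2 * M * p.2.1 + ((4 * M * a ^ 2 : ℝ) : ℂ) * p.2.2 -
      ((6 * M * a ^ 2 : ℝ) : ℂ) * p.1 ^ 2) * (r : ℂ) +
    (p.2.1 * ((a ^ 2 : ℝ) : ℂ) - ((a ^ 2 * (m : ℝ) ^ 2 + horD M a ^ 2 / 4 : ℝ) : ℂ) +
      (p.1 ^ 2 - p.2.2) * ((a ^ 4 : ℝ) : ℂ))

/-- A bound for the coefficients of `N` on the box `‖ω‖, ‖Λ‖, ‖σ‖ ≤ R`. [folklore] -/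
def radNBound (R : ℝ) : ℝ :=
  2 * |M| * (R + 2 * R ^ 2) + (R + (a ^ 2 + 4 * M ^ 2) * (R ^ 2 + R)) +
    (4 * |M| * |a| * |(m : ℝ)| * R + 2 * |M| * R + 4 * |M| * a ^ 2 * R + 6 * |M| * a ^ 2 * R ^ 2) +
    (R * a ^ 2 + (a ^ 2 * (m : ℝ) ^ 2 + horD M a ^ 2 / 4) + (R ^ 2 + R) * a ^ 4)

variable {M a m}

/-- `radNBound ≥ 0`. [folklore] -/
theorem radNBound_nonneg {R : ℝ} (hR : 0 ≤ R) : 0 ≤ radNBound M a m R := by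
  unfold radNBound; positivity

/-- `V − d²/4 = (σ − ω²)Δ² + N`. [folklore] -/
theorem radPot_sub_eq (p : ℂ × ℂ × ℂ) (r : ℝ) :
    radPot M a m p r - ((horD M a ^ 2 / 4 : ℝ) : ℂ) =
      (p.2.2 - p.1 ^ 2) * ((Kerr.delta M a r ^ 2 : ℝ) : ℂ) + radN M a m p r := by
  simp only [radPot, radN, Kerr.delta]
  push_cast
  ring

/-- **`Q = (σ − ω²) + N/Δ²`** on `(r₊, ∞)`. [folklore] -/
theorem radQ_eq_add (h : |a| ≤ M) (p : ℂ × ℂ × ℂ) {r : ℝ} (hr : Kerr.rPlus M a < r) :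
    radQ M a m p r = (p.2.2 - p.1 ^ 2) + radN M a m p r / ((Kerr.delta M a r ^ 2 : ℝ) : ℂ) := by
  have hΔ : ((Kerr.delta M a r ^ 2 : ℝ) : ℂ) ≠ 0 := by exact_mod_cast (pow_ne_zero 2 (Kerr.delta_pos h hr).ne')
  rw [radQ, radPot_sub_eq, add_div, mul_div_cancel_right₀ _ hΔ]

/-- `‖N(r)‖ ≤ B r³` for `r ≥ 1` and parameters in the box. [folklore] -/
theorem norm_radN_le {R : ℝ} (hR : 0 ≤ R) {p : ℂ × ℂ × ℂ} (hp : p ∈ horBoxClosed R) {r : ℝ} (hr : 1 ≤ r) :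
    ‖radN M a m p r‖ ≤ radNBound M a m R * r ^ 3 := by
  obtain ⟨hω, hΛ, hσ⟩ := hp
  have hr0 : 0 ≤ r := by linarith
  have hr2 : r ^ 2 ≤ r ^ 3 := by nlinarith
  have hr1 : r ≤ r ^ 3 := by nlinarith
  have hr3 : (1 : ℝ) ≤ r ^ 3 := by nlinarith
  have hω2 : ‖p.1 ^ 2‖ ≤ R ^ 2 := by rw [norm_pow]; gcongr
  have hnR : ∀ x : ℝ, ‖((x : ℝ) : ℂ)‖ = |x| := fun x ↦ by rw [Complex.norm_real, Real.norm_eq_abs]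
  have h2 : ‖(2 : ℂ)‖ = 2 := by norm_num
  have hM : ‖(M : ℂ)‖ = |M| := hnR M
  -- coefficient bounds
  have c3 : ‖2 * (M : ℂ) * (p.2.2 - 2 * p.1 ^ 2)‖ ≤ 2 * |M| * (R + 2 * R ^ 2) := by
    rw [norm_mul, norm_mul, h2, hM]
    gcongr
    refine (norm_sub_le _ _).trans (add_le_add hσ ?_)
    rw [norm_mul, h2]; gcongr
  have c2 : ‖p.2.1 + ((a ^ 2 + 4 * M ^ 2 : ℝ) : ℂ) * (p.1 ^ 2 - p.2.2)‖ ≤ R + (a ^ 2 + 4 * M ^ 2) * (R ^ 2 + R) := by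
    refine (norm_add_le _ _).trans (add_le_add hΛ ?_)
    rw [norm_mul, hnR, abs_of_nonneg (by positivity)]
    gcongr
    exact (norm_sub_le _ _).trans (add_le_add hω2 hσ)
  have c1 : ‖((4 * M * a * m : ℝ) : ℂ) * p.1 - 2 * M * p.2.1 + ((4 * M * a ^ 2 : ℝ) : ℂ) * p.2.2 -
      ((6 * M * a ^ 2 : ℝ) : ℂ) * p.1 ^ 2‖ ≤
      4 * |M| * |a| * |(m : ℝ)| * R + 2 * |M| * R + 4 * |M| * a ^ 2 * R + 6 * |M| * a ^ 2 * R ^ 2 := by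
    refine (norm_sub_le _ _).trans (add_le_add ((norm_add_le _ _).trans (add_le_add ((norm_sub_le _ _).trans
      (add_le_add ?_ ?_)) ?_)) ?_)
    · rw [norm_mul, hnR, abs_mul, abs_mul, abs_mul, Nat.abs_ofNat]
      gcongr
    · rw [norm_mul, norm_mul, h2, hM]; gcongr
    · rw [norm_mul, hnR, abs_mul, abs_mul, Nat.abs_ofNat, abs_of_nonneg (sq_nonneg a)]
      gcongr
    · rw [norm_mul, hnR, abs_mul, abs_mul, Nat.abs_ofNat, abs_of_nonneg (sq_nonneg a)]
      gcongr
  have c0 : ‖p.2.1 * ((a ^ 2 : ℝ) : ℂ) - ((a ^ 2 * (m : ℝ) ^ 2 + horD M a ^ 2 / 4 : ℝ) : ℂ) +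
      (p.1 ^ 2 - p.2.2) * ((a ^ 4 : ℝ) : ℂ)‖ ≤
      R * a ^ 2 + (a ^ 2 * (m : ℝ) ^ 2 + horD M a ^ 2 / 4) + (R ^ 2 + R) * a ^ 4 := by
    refine (norm_add_le _ _).trans (add_le_add ((norm_sub_le _ _).trans (add_le_add ?_ ?_)) ?_)
    · rw [norm_mul, hnR, abs_of_nonneg (sq_nonneg a)]; gcongr
    · rw [hnR, abs_of_nonneg (by positivity)]
    · rw [norm_mul, hnR, abs_of_nonneg (by positivity)]
      gcongr
      exact (norm_sub_le _ _).trans (add_le_add hω2 hσ)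
  -- powers of `r`
  have e3 : ‖((r ^ 3 : ℝ) : ℂ)‖ = r ^ 3 := by rw [hnR, abs_of_nonneg (by positivity)]
  have e2 : ‖((r ^ 2 : ℝ) : ℂ)‖ = r ^ 2 := by rw [hnR, abs_of_nonneg (by positivity)]
  have e1 : ‖(r : ℂ)‖ = r := by rw [hnR, abs_of_nonneg hr0]
  have hB3 : 0 ≤ 2 * |M| * (R + 2 * R ^ 2) := by positivity
  have hB2 : 0 ≤ R + (a ^ 2 + 4 * M ^ 2) * (R ^ 2 + R) := by positivity
  have hB1 : 0 ≤ 4 * |M| * |a| * |(m : ℝ)| * R + 2 * |M| * R + 4 * |M| * a ^ 2 * R + 6 * |M| * a ^ 2 * R ^ 2 := by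
    positivity
  have hB0 : 0 ≤ R * a ^ 2 + (a ^ 2 * (m : ℝ) ^ 2 + horD M a ^ 2 / 4) + (R ^ 2 + R) * a ^ 4 := by positivity
  unfold radN radNBound
  refine (norm_add_le _ _).trans ?_
  refine (add_le_add ((norm_add_le _ _).trans (add_le_add ((norm_add_le _ _).trans (add_le_add le_rfl le_rfl))
    le_rfl)) le_rfl).trans ?_
  have t3 : ‖2 * (M : ℂ) * (p.2.2 - 2 * p.1 ^ 2) * ((r ^ 3 : ℝ) : ℂ)‖ ≤ 2 * |M| * (R + 2 * R ^ 2) * r ^ 3 := by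
    rw [norm_mul, e3]; exact mul_le_mul_of_nonneg_right c3 (by positivity)
  have t2 : ‖(p.2.1 + ((a ^ 2 + 4 * M ^ 2 : ℝ) : ℂ) * (p.1 ^ 2 - p.2.2)) * ((r ^ 2 : ℝ) : ℂ)‖ ≤
      (R + (a ^ 2 + 4 * M ^ 2) * (R ^ 2 + R)) * r ^ 3 := by
    rw [norm_mul, e2]
    exact (mul_le_mul_of_nonneg_right c2 (by positivity)).trans (mul_le_mul_of_nonneg_left hr2 hB2)
  have t1 : ‖(((4 * M * a * m : ℝ) : ℂ) * p.1 - 2 * M * p.2.1 + ((4 * M * a ^ 2 : ℝ) : ℂ) * p.2.2 -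
      ((6 * M * a ^ 2 : ℝ) : ℂ) * p.1 ^ 2) * (r : ℂ)‖ ≤
      (4 * |M| * |a| * |(m : ℝ)| * R + 2 * |M| * R + 4 * |M| * a ^ 2 * R + 6 * |M| * a ^ 2 * R ^ 2) * r ^ 3 := by
    rw [norm_mul, e1]
    exact (mul_le_mul_of_nonneg_right c1 hr0).trans (mul_le_mul_of_nonneg_left hr1 hB1)
  have t0 : ‖p.2.1 * ((a ^ 2 : ℝ) : ℂ) - ((a ^ 2 * (m : ℝ) ^ 2 + horD M a ^ 2 / 4 : ℝ) : ℂ) +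
      (p.1 ^ 2 - p.2.2) * ((a ^ 4 : ℝ) : ℂ)‖ ≤
      (R * a ^ 2 + (a ^ 2 * (m : ℝ) ^ 2 + horD M a ^ 2 / 4) + (R ^ 2 + R) * a ^ 4) * r ^ 3 := by
    calc _ ≤ (R * a ^ 2 + (a ^ 2 * (m : ℝ) ^ 2 + horD M a ^ 2 / 4) + (R ^ 2 + R) * a ^ 4) * 1 := by
          rw [mul_one]; exact c0
      _ ≤ _ := mul_le_mul_of_nonneg_left hr3 hB0
  linarith

/-- Far out, `Δ ≥ (r − r₊)²` and `r ≤ (1 + r₊)(r − r₊)` (`r ≥ r₊ + 1`, `r₋ ≤ r₊`, `r₊ ≥ 0`). [folklore] -/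
theorem sq_le_delta (h : Kerr.IsSubextremal M a) {r : ℝ} (hr : Kerr.rPlus M a + 1 ≤ r) :
    (r - Kerr.rPlus M a) ^ 2 ≤ Kerr.delta M a r ∧ r ≤ (1 + Kerr.rPlus M a) * (r - Kerr.rPlus M a) := by
  have hrp := rPlus_pos_of_isSubextremal h
  have hrm := h.rMinus_lt_rPlus
  constructor
  · rw [Kerr.delta_eq_mul h.le r]
    nlinarith
  · nlinarith

/-- **The asymptotic bound**: for `r ≥ r₊ + 1` and parameters in the box,
`‖Q(r) − (σ − ω²)‖ ≤ B (1 + r₊)³ / (r − r₊)`. [folklore] -/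
theorem norm_radQ_sub_le (h : Kerr.IsSubextremal M a) {R : ℝ} (hR : 0 ≤ R) {p : ℂ × ℂ × ℂ}
    (hp : p ∈ horBoxClosed R) {r : ℝ} (hr : Kerr.rPlus M a + 1 ≤ r) :
    ‖radQ M a m p r - (p.2.2 - p.1 ^ 2)‖ ≤
      radNBound M a m R * (1 + Kerr.rPlus M a) ^ 3 / (r - Kerr.rPlus M a) := by
  have hrp := rPlus_pos_of_isSubextremal h
  have hr' : Kerr.rPlus M a < r := by linarith
  have hx : 0 < r - Kerr.rPlus M a := by linarith
  have hr0 : 0 ≤ r := by linarith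
  obtain ⟨hΔ, hrle⟩ := sq_le_delta h hr
  have hΔpos := Kerr.delta_pos h.le hr'
  rw [radQ_eq_add h.le p hr', add_sub_cancel_left, norm_div, Complex.norm_real, Real.norm_eq_abs,
    abs_of_pos (pow_pos hΔpos 2)]
  have hN := norm_radN_le (M := M) (a := a) (m := m) hR hp (r := r) (by linarith)
  have hB : 0 ≤ radNBound M a m R := radNBound_nonneg hR
  rw [div_le_div_iff₀ (pow_pos hΔpos 2) hx]
  calc ‖radN M a m p r‖ * (r - Kerr.rPlus M a) ≤ radNBound M a m R * r ^ 3 * (r - Kerr.rPlus M a) := by gcongr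
    _ ≤ radNBound M a m R * ((1 + Kerr.rPlus M a) * (r - Kerr.rPlus M a)) ^ 3 * (r - Kerr.rPlus M a) := by
        gcongr
    _ = radNBound M a m R * (1 + Kerr.rPlus M a) ^ 3 * ((r - Kerr.rPlus M a) ^ 2 * (r - Kerr.rPlus M a) ^ 2) := by
        ring
    _ ≤ radNBound M a m R * (1 + Kerr.rPlus M a) ^ 3 * (Kerr.delta M a r * Kerr.delta M a r) := by
        gcongr
    _ = radNBound M a m R * (1 + Kerr.rPlus M a) ^ 3 * Kerr.delta M a r ^ 2 := by ring

/-- **The dichotomy region.** If `re (σ − ω²) ≥ 2γ²` (`γ > 0`) then for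
`r ≥ r₊ + 1 + B(1 + r₊)³/γ²` one has `re Q(r) ≥ γ²` and `‖Q(r)‖ ≤ ‖σ − ω²‖ + γ²`. [folklore] -/
theorem re_radQ_ge (h : Kerr.IsSubextremal M a) {R : ℝ} (hR : 0 ≤ R) {p : ℂ × ℂ × ℂ}
    (hp : p ∈ horBoxClosed R) {γ : ℝ} (hγ : 0 < γ) (hre : 2 * γ ^ 2 ≤ (p.2.2 - p.1 ^ 2).re) {r : ℝ}
    (hr : Kerr.rPlus M a + 1 + radNBound M a m R * (1 + Kerr.rPlus M a) ^ 3 / γ ^ 2 ≤ r) :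
    γ ^ 2 ≤ (radQ M a m p r).re ∧ ‖radQ M a m p r‖ ≤ ‖p.2.2 - p.1 ^ 2‖ + γ ^ 2 := by
  have hrp := rPlus_pos_of_isSubextremal h
  have hB : 0 ≤ radNBound M a m R * (1 + Kerr.rPlus M a) ^ 3 := by
    have := radNBound_nonneg (M := M) (a := a) (m := m) hR
    positivity
  have hr1 : Kerr.rPlus M a + 1 ≤ r := by
    have : 0 ≤ radNBound M a m R * (1 + Kerr.rPlus M a) ^ 3 / γ ^ 2 := by positivity
    linarith
  have hx : 0 < r - Kerr.rPlus M a := by linarith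
  have hbound := norm_radQ_sub_le (m := m) h hR hp hr1
  -- the error is `≤ γ²`
  have herr : radNBound M a m R * (1 + Kerr.rPlus M a) ^ 3 / (r - Kerr.rPlus M a) ≤ γ ^ 2 := by
    rw [div_le_iff₀ hx]
    have h1 : radNBound M a m R * (1 + Kerr.rPlus M a) ^ 3 / γ ^ 2 ≤ r - Kerr.rPlus M a - 1 := by linarith
    have h2 := (div_le_iff₀ (by positivity : (0 : ℝ) < γ ^ 2)).1 h1
    nlinarith
  have hsmall : ‖radQ M a m p r - (p.2.2 - p.1 ^ 2)‖ ≤ γ ^ 2 := hbound.trans herr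
  constructor
  · have hre' : (radQ M a m p r).re = (p.2.2 - p.1 ^ 2).re + (radQ M a m p r - (p.2.2 - p.1 ^ 2)).re := by
      simp
    rw [hre']
    have := (Complex.abs_re_le_norm (radQ M a m p r - (p.2.2 - p.1 ^ 2))).trans hsmall
    have := neg_le_of_abs_le this
    linarith
  · calc ‖radQ M a m p r‖ = ‖(p.2.2 - p.1 ^ 2) + (radQ M a m p r - (p.2.2 - p.1 ^ 2))‖ := by ring_nf
      _ ≤ ‖p.2.2 - p.1 ^ 2‖ + ‖radQ M a m p r - (p.2.2 - p.1 ^ 2)‖ := norm_add_le _ _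
      _ ≤ _ := by linarith

end Asymptotics

/-! ### The horizon phase `Φ` and `G = √Δ Φ` -/

section Phase

variable (M a : ℝ) (m : ℤ)

/-- The phase exponent `θ(r) = (β/d) log(r − r₊) − (β₋/d) log(r − r₋)`, `β = am − 2Mωr₊`,
`β₋ = am − 2Mωr₋` (`θ' = −K/Δ`; compare `−(ω(t̄ − r) − mφ̄)`, SR §1.2.1). [cite: ShlapentokhRothman2014KleinGordon, §1.2.1] -/
def radTheta (w : ℂ) (r : ℝ) : ℂ :=
  horBeta M a m w / (horD M a : ℂ) * ((Real.log (r - Kerr.rPlus M a) : ℝ) : ℂ) -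
    ((a * m : ℝ) - 2 * M * w * Kerr.rMinus M a) / (horD M a : ℂ) * ((Real.log (r - Kerr.rMinus M a) : ℝ) : ℂ)

/-- **The horizon phase** `Φ = exp(i θ)`. [cite: ShlapentokhRothman2014KleinGordon, §2 (2.4)] -/
def radPhase (w : ℂ) (r : ℝ) : ℂ := Complex.exp (Complex.I * radTheta M a m w r)

/-- `G = √Δ · Φ`. [folklore] -/
def radG (w : ℂ) (r : ℝ) : ℂ := ((Real.sqrt (Kerr.delta M a r) : ℝ) : ℂ) * radPhase M a m w r

/-- The logarithmic derivative `f = Δ'/(2Δ) − iK/Δ` of `G`. [folklore] -/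
def radLogG (w : ℂ) (r : ℝ) : ℂ :=
  (((2 * (r - M)) / (2 * Kerr.delta M a r) : ℝ) : ℂ) - Complex.I * radK M a m w r / (Kerr.delta M a r : ℂ)

/-- `G₁ = G · (Δ'/(2Δ) − iK/Δ)` (its derivative). [folklore] -/
def radG₁ (w : ℂ) (r : ℝ) : ℂ := radG M a m w r * radLogG M a m w r

variable {M a m}

/-- `θ' = −K/Δ` on `(r₊, ∞)`. [folklore] -/
theorem hasDerivAt_radTheta (h : Kerr.IsSubextremal M a) (w : ℂ) {r : ℝ} (hr : Kerr.rPlus M a < r) :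
    HasDerivAt (radTheta M a m w) (-radK M a m w r / (Kerr.delta M a r : ℂ)) r := by
  have hd := horD_pos h
  have h1 : 0 < r - Kerr.rPlus M a := sub_pos.2 hr
  have h2 : 0 < r - Kerr.rMinus M a := sub_pos.2 (h.rMinus_lt_rPlus.trans hr)
  have hl1 : HasDerivAt (fun s : ℝ ↦ ((Real.log (s - Kerr.rPlus M a) : ℝ) : ℂ)) (((1 / (r - Kerr.rPlus M a) : ℝ) : ℂ)) r := by
    have := ((hasDerivAt_id r).sub_const (Kerr.rPlus M a)).log h1.ne'
    simpa using this.ofReal_comp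
  have hl2 : HasDerivAt (fun s : ℝ ↦ ((Real.log (s - Kerr.rMinus M a) : ℝ) : ℂ)) (((1 / (r - Kerr.rMinus M a) : ℝ) : ℂ)) r := by
    have := ((hasDerivAt_id r).sub_const (Kerr.rMinus M a)).log h2.ne'
    simpa using this.ofReal_comp
  have hsum := (hl1.const_mul (horBeta M a m w / (horD M a : ℂ))).sub
    (hl2.const_mul (((a * m : ℝ) - 2 * M * w * Kerr.rMinus M a) / (horD M a : ℂ)))
  refine hsum.congr_deriv ?_
  have hΔ : Kerr.delta M a r = (r - Kerr.rPlus M a) * (r - Kerr.rMinus M a) := Kerr.delta_eq_mul h.le r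
  have hdd : horD M a = Kerr.rPlus M a - Kerr.rMinus M a := rfl
  have hd0 : (Kerr.rPlus M a : ℂ) - (Kerr.rMinus M a : ℂ) ≠ 0 := sub_ne_zero.2 (by exact_mod_cast h.rMinus_lt_rPlus.ne')
  have h10 : (r : ℂ) - (Kerr.rPlus M a : ℂ) ≠ 0 := sub_ne_zero.2 (by exact_mod_cast hr.ne')
  have h20 : (r : ℂ) - (Kerr.rMinus M a : ℂ) ≠ 0 :=
    sub_ne_zero.2 (by exact_mod_cast (h.rMinus_lt_rPlus.trans hr).ne')
  rw [hΔ, hdd]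
  simp only [radK, horBeta]
  push_cast
  field_simp
  ring

/-- **`Φ' = −(iK/Δ) Φ`** on `(r₊, ∞)`. [cite: ShlapentokhRothman2014KleinGordon, §2 (2.4)] -/
theorem hasDerivAt_radPhase (h : Kerr.IsSubextremal M a) (w : ℂ) {r : ℝ} (hr : Kerr.rPlus M a < r) :
    HasDerivAt (radPhase M a m w) (radPhase M a m w r * (-(Complex.I * radK M a m w r / (Kerr.delta M a r : ℂ)))) r := by
  have h1 := ((hasDerivAt_radTheta (m := m) h w hr).const_mul Complex.I).cexp
  refine h1.congr_deriv ?_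
  simp only [radPhase]
  ring

/-- **`G' = G₁ = G (Δ'/(2Δ) − iK/Δ)`** on `(r₊, ∞)`. [folklore] -/
theorem hasDerivAt_radG (h : Kerr.IsSubextremal M a) (w : ℂ) {r : ℝ} (hr : Kerr.rPlus M a < r) :
    HasDerivAt (radG M a m w) (radG₁ M a m w r) r := by
  have hΔ := Kerr.delta_pos h.le hr
  have hs : HasDerivAt (fun s : ℝ ↦ ((Real.sqrt (Kerr.delta M a s) : ℝ) : ℂ))
      (((2 * (r - M) / (2 * Real.sqrt (Kerr.delta M a r)) : ℝ) : ℂ)) r := by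
    have := (Kerr.hasDerivAt_delta M a r).sqrt hΔ.ne'
    exact this.ofReal_comp
  have h1 := hs.mul (hasDerivAt_radPhase (m := m) h w hr)
  refine h1.congr_deriv ?_
  have hsq : ((Real.sqrt (Kerr.delta M a r) : ℝ) : ℂ) ^ 2 = (Kerr.delta M a r : ℂ) := by
    rw [← Complex.ofReal_pow, Real.sq_sqrt hΔ.le]
  have hs0 : ((Real.sqrt (Kerr.delta M a r) : ℝ) : ℂ) ≠ 0 := by
    exact_mod_cast (Real.sqrt_pos.2 hΔ).ne'
  have hΔ0 : (Kerr.delta M a r : ℂ) ≠ 0 := by exact_mod_cast hΔ.ne'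
  simp only [radG₁, radG, radLogG]
  push_cast
  rw [← hsq]
  field_simp
  ring

/-- For real `ω`, `‖Φ‖ = 1`. [folklore] -/
theorem norm_radPhase_of_im_eq_zero {w : ℂ} (hw : w.im = 0) (r : ℝ) : ‖radPhase M a m w r‖ = 1 := by
  rw [radPhase, Complex.norm_exp]
  have : (Complex.I * radTheta M a m w r).re = 0 := by
    rw [Complex.mul_re, Complex.I_re, Complex.I_im, zero_mul, one_mul, zero_sub, neg_eq_zero]
    simp [radTheta, horBeta, Complex.mul_im, Complex.div_im, hw]
  rw [this, Real.exp_zero]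

/-- `G ≠ 0` on `(r₊, ∞)`. [folklore] -/
theorem radG_ne_zero (h : Kerr.IsSubextremal M a) (w : ℂ) {r : ℝ} (hr : Kerr.rPlus M a < r) : radG M a m w r ≠ 0 := by
  have hΔ := Kerr.delta_pos h.le hr
  have hs0 : ((Real.sqrt (Kerr.delta M a r) : ℝ) : ℂ) ≠ 0 := by exact_mod_cast (Real.sqrt_pos.2 hΔ).ne'
  exact mul_ne_zero hs0 (Complex.exp_ne_zero _)

/-- For real `ω`, `‖G(r)‖² = Δ(r)` on `(r₊, ∞)`. [folklore] -/
theorem norm_radG_sq (h : |a| ≤ M) {w : ℂ} (hw : w.im = 0) {r : ℝ} (hr : Kerr.rPlus M a < r) :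
    ‖radG M a m w r‖ ^ 2 = Kerr.delta M a r := by
  rw [radG, norm_mul, norm_radPhase_of_im_eq_zero hw, mul_one, Complex.norm_real, Real.norm_eq_abs,
    abs_of_nonneg (Real.sqrt_nonneg _), Real.sq_sqrt (Kerr.delta_pos h hr).le]

end Phase

/-! ### From the ingoing chart to Liouville normal form -/

section Conversion

variable {M a : ℝ} {m : ℤ}

/-- The derivative of the logarithmic derivative `f = Δ'/(2Δ) − iK/Δ`. [folklore] -/
theorem hasDerivAt_radLogG (h : |a| ≤ M) (w : ℂ) {r : ℝ} (hr : Kerr.rPlus M a < r) :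
    HasDerivAt (radLogG M a m w)
      ((((2 * (2 * Kerr.delta M a r) - 2 * (r - M) * (2 * (2 * (r - M)))) / (2 * Kerr.delta M a r) ^ 2 : ℝ) : ℂ) -
        (Complex.I * (2 * M * w) * (Kerr.delta M a r : ℂ) - Complex.I * radK M a m w r * ((2 * (r - M) : ℝ) : ℂ)) /
          (Kerr.delta M a r : ℂ) ^ 2) r := by
  have hΔ := Kerr.delta_pos h hr
  have hΔd : HasDerivAt (fun s : ℝ ↦ (Kerr.delta M a s : ℂ)) (((2 * (r - M) : ℝ) : ℂ)) r :=
    (Kerr.hasDerivAt_delta M a r).ofReal_comp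
  have hΔ0 : (Kerr.delta M a r : ℂ) ≠ 0 := by exact_mod_cast hΔ.ne'
  have hf1 : HasDerivAt (fun s : ℝ ↦ (((2 * (s - M)) / (2 * Kerr.delta M a s) : ℝ) : ℂ))
      (((2 * (2 * Kerr.delta M a r) - 2 * (r - M) * (2 * (2 * (r - M)))) / (2 * Kerr.delta M a r) ^ 2 : ℝ) : ℂ) r := by
    have hn : HasDerivAt (fun s : ℝ ↦ 2 * (s - M)) 2 r := by
      simpa using ((hasDerivAt_id r).sub_const M).const_mul (2 : ℝ)
    have hd : HasDerivAt (fun s : ℝ ↦ 2 * Kerr.delta M a s) (2 * (2 * (r - M))) r :=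
      (Kerr.hasDerivAt_delta M a r).const_mul 2
    exact (hn.div hd (by positivity)).ofReal_comp
  have hK : HasDerivAt (fun s : ℝ ↦ radK M a m w s) (2 * M * w) r := by
    have h1 : HasDerivAt (fun s : ℝ ↦ (s : ℂ)) 1 r := Complex.ofRealCLM.hasDerivAt
    have := (h1.const_mul (2 * (M : ℂ) * w)).sub_const ((a * m : ℝ) : ℂ)
    simpa [radK] using this
  have hf2 : HasDerivAt (fun s : ℝ ↦ Complex.I * radK M a m w s / (Kerr.delta M a s : ℂ))
      ((Complex.I * (2 * M * w) * (Kerr.delta M a r : ℂ) - Complex.I * radK M a m w r * ((2 * (r - M) : ℝ) : ℂ)) /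
        (Kerr.delta M a r : ℂ) ^ 2) r := (hK.const_mul Complex.I).div hΔd hΔ0
  exact hf1.sub hf2

/-- **The conversion identity.** If `u` has derivative `u₁ r` at `r > r₊`, `u₁` has derivative
`u₂` at `r`, and the ingoing equation holds at `r`, `Δ u₂ + (Δ' − 2iK) u₁ r + W u r = 0`, then
`y = G u` has derivative `y₁ = G₁ u + G u₁` at `r` and `y₁` has derivative `Q r · y r` at `r`
(`2G'/G = (Δ' − 2iK)/Δ` kills the first-order term and `G''/G = W/Δ + Q`).
[cite: ShlapentokhRothman2014KleinGordon, §2 (2.2)–(2.4)] -/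
theorem hasDerivAt_liouville (h : Kerr.IsSubextremal M a) (p : ℂ × ℂ × ℂ) {u u₁ : ℝ → ℂ} {u₂ : ℂ} {r : ℝ}
    (hr : Kerr.rPlus M a < r) (hu : HasDerivAt u (u₁ r) r) (hu₁ : HasDerivAt u₁ u₂ r)
    (hode : (Kerr.delta M a r : ℂ) * u₂ + (((2 * (r - M) : ℝ) : ℂ) - 2 * Complex.I * radK M a m p.1 r) * u₁ r +
      radW M p r * u r = 0) :
    HasDerivAt (fun s ↦ radG M a m p.1 s * u s) (radG₁ M a m p.1 r * u r + radG M a m p.1 r * u₁ r) r ∧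
      HasDerivAt (fun s ↦ radG₁ M a m p.1 s * u s + radG M a m p.1 s * u₁ s)
        (radQ M a m p r * (radG M a m p.1 r * u r)) r := by
  have hΔ := Kerr.delta_pos h.le hr
  have hG := hasDerivAt_radG (m := m) h p.1 hr
  refine ⟨hG.mul hu, ?_⟩
  have hf := hasDerivAt_radLogG (m := m) h.le p.1 hr
  have hG₁ : HasDerivAt (radG₁ M a m p.1) (radG₁ M a m p.1 r * radLogG M a m p.1 r + radG M a m p.1 r * _) r :=
    hG.mul hf
  have hy₁ := (hG₁.mul hu).add (hG.mul hu₁)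
  refine hy₁.congr_deriv ?_
  -- algebra
  have hΔ0 : (Kerr.delta M a r : ℂ) ≠ 0 := by exact_mod_cast hΔ.ne'
  have hu₂ : u₂ = -((((2 * (r - M) : ℝ) : ℂ) - 2 * Complex.I * radK M a m p.1 r) * u₁ r + radW M p r * u r) /
      (Kerr.delta M a r : ℂ) := by
    rw [eq_div_iff hΔ0]; linear_combination hode
  have hV : radPot M a m p r = -radK M a m p.1 r ^ 2 - (Kerr.delta M a r : ℂ) * (radW M p r + 2 * Complex.I * M * p.1) := by
    linear_combination radPot_add_sq_radK (M := M) (a := a) (m := m) p r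
  have hd2 : ((horD M a ^ 2 / 4 : ℝ) : ℂ) = (((2 * (r - M)) ^ 2 - 4 * Kerr.delta M a r) / 4 : ℝ) := by
    rw [sq_deriv_delta h r]; push_cast; ring
  simp only [radG₁, radQ, radLogG, hu₂, hV, hd2]
  simp only [radK]
  push_cast
  field_simp
  linear_combination (4 * radG M a m p.1 r * u r * (2 * (r : ℂ) * M * p.1 - a * m) ^ 2) * Complex.I_sq

end Conversion

/-! ### The horizon-regular solution in the real radial variable -/

section HorizonSolution

variable (M a : ℝ) (m : ℤ)

/-- `u(r; p) = horFun p (r − r₊)`: the Frobenius solution of the ingoing equation as a function of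
the real radius. [cite: ShlapentokhRothman2014KleinGordon, §2 (2.5)] -/
def horU (p : ℂ × ℂ × ℂ) (r : ℝ) : ℂ := horFun M a m p ((r : ℂ) - Kerr.rPlus M a)

/-- Its first `r`-derivative (valid on `|r − r₊| < ρ(R)/2` for `p` in the box of size `R`). [folklore] -/
def horU₁ (R : ℝ) (p : ℂ × ℂ × ℂ) (r : ℝ) : ℂ := horDer M a m R p ((r : ℂ) - Kerr.rPlus M a)

/-- Its second `r`-derivative (same proviso). [folklore] -/
def horU₂ (R : ℝ) (p : ℂ × ℂ × ℂ) (r : ℝ) : ℂ := horDer2 M a m R p ((r : ℂ) - Kerr.rPlus M a)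

variable {M a m}

/-- `|r − c| < ρ` gives `‖(r : ℂ) − c‖ < ρ`. [folklore] -/
theorem norm_ofReal_sub_ofReal_lt {r c ρ : ℝ} (hr : |r - c| < ρ) : ‖(r : ℂ) - c‖ < ρ := by
  rw [← Complex.ofReal_sub, Complex.norm_real, Real.norm_eq_abs]; exact hr

/-- `u(r₊; p) = 1`. [folklore] -/
theorem horU_rPlus (h : Kerr.IsSubextremal M a) (p : ℂ × ℂ × ℂ) : horU M a m p (Kerr.rPlus M a) = 1 := by
  rw [horU, sub_self, horFun_zero h m p]

section
variable (h : Kerr.IsSubextremal M a) {R : ℝ} (hR : 0 ≤ R) {p : ℂ × ℂ × ℂ} (hp : p ∈ horGood M a)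
  (hpR : p ∈ horBoxClosed R)
include h hR hp hpR

/-- `u' = u₁` on `|r − r₊| < ρ(R)/2`. [folklore] -/
theorem hasDerivAt_horU {r : ℝ} (hr : |r - Kerr.rPlus M a| < horRho M a R / 2) :
    HasDerivAt (horU M a m p) (horU₁ M a m R p r) r := by
  have h1 := hasDerivAt_horFun h m hR hp hpR (norm_ofReal_sub_ofReal_lt hr)
  have h2 : HasDerivAt (fun z : ℂ ↦ z - Kerr.rPlus M a) 1 (r : ℂ) := (hasDerivAt_id _).sub_const _
  have h3 := (h1.comp (r : ℂ) h2).comp_ofReal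
  exact h3.congr_deriv (mul_one _)

/-- `u₁' = u₂` on `|r − r₊| < ρ(R)/2`. [folklore] -/
theorem hasDerivAt_horU₁ {r : ℝ} (hr : |r - Kerr.rPlus M a| < horRho M a R / 2) :
    HasDerivAt (horU₁ M a m R p) (horU₂ M a m R p r) r := by
  have h1 := hasDerivAt_horDer h m hR hp hpR (norm_ofReal_sub_ofReal_lt hr)
  have h2 : HasDerivAt (fun z : ℂ ↦ z - Kerr.rPlus M a) 1 (r : ℂ) := (hasDerivAt_id _).sub_const _
  have h3 := (h1.comp (r : ℂ) h2).comp_ofReal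
  exact h3.congr_deriv (mul_one _)

/-- `u`, `u₁` are continuous at `r₊`. [folklore] -/
theorem continuousAt_horU_rPlus :
    ContinuousAt (horU M a m p) (Kerr.rPlus M a) ∧ ContinuousAt (horU₁ M a m R p) (Kerr.rPlus M a) := by
  have h0 : |Kerr.rPlus M a - Kerr.rPlus M a| < horRho M a R / 2 := by
    rw [sub_self, abs_zero]; exact half_pos (horRho_pos h hR)
  exact ⟨(hasDerivAt_horU h hR hp hpR h0).continuousAt, (hasDerivAt_horU₁ h hR hp hpR h0).continuousAt⟩

/-- **The ingoing equation in the real radius**: `Δ u₂ + (Δ' − 2iK) u₁ + W u = 0` on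
`|r − r₊| < ρ(R)/2`. [cite: ShlapentokhRothman2014KleinGordon, §2 (2.5)] -/
theorem horU_ode {r : ℝ} (hr : |r - Kerr.rPlus M a| < horRho M a R / 2) :
    (Kerr.delta M a r : ℂ) * horU₂ M a m R p r +
      (((2 * (r - M) : ℝ) : ℂ) - 2 * Complex.I * radK M a m p.1 r) * horU₁ M a m R p r +
      radW M p r * horU M a m p r = 0 := by
  have hode := horFun_ode h m hR hp hpR (norm_ofReal_sub_ofReal_lt hr)
  simp only [horU, horU₁, horU₂]
  set x : ℂ := (r : ℂ) - Kerr.rPlus M a with hx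
  have e1 : (Kerr.delta M a r : ℂ) = x * (x + horD M a) := by
    rw [Kerr.delta_eq_mul h.le r, horD]; push_cast; ring
  have hM : (M : ℂ) = (((Kerr.rPlus M a + Kerr.rMinus M a) / 2 : ℝ) : ℂ) := by
    rw [Kerr.rPlus_add_rMinus]; push_cast; ring
  have e2 : ((2 * (r - M) : ℝ) : ℂ) - 2 * Complex.I * radK M a m p.1 r =
      (2 - 4 * Complex.I * M * p.1) * x + ((horD M a : ℂ) + 2 * Complex.I * horBeta M a m p.1) := by
    simp only [radK, horBeta, horD, hx]
    push_cast
    rw [hM]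
    push_cast
    ring
  have e3 : radW M p r = horQ2 p * x ^ 2 + horQ1 M a p * x + horQ0 M a p := by
    simp only [radW, horQ2, horQ1, horQ0, hx]; push_cast; ring
  rw [e1, e2, e3]
  linear_combination hode

/-- **`y = G u` solves `y'' = Q y`** at every `r ∈ (r₊, r₊ + ρ(R)/2)`, with `y' = G₁ u + G u₁`.
[cite: ShlapentokhRothman2014KleinGordon, §2 (2.2)–(2.5)] -/
theorem hasDerivAt_radG_mul_horU {r : ℝ} (hr0 : Kerr.rPlus M a < r) (hr : |r - Kerr.rPlus M a| < horRho M a R / 2) :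
    HasDerivAt (fun s ↦ radG M a m p.1 s * horU M a m p s)
        (radG₁ M a m p.1 r * horU M a m p r + radG M a m p.1 r * horU₁ M a m R p r) r ∧
      HasDerivAt (fun s ↦ radG₁ M a m p.1 s * horU M a m p s + radG M a m p.1 s * horU₁ M a m R p s)
        (radQ M a m p r * (radG M a m p.1 r * horU M a m p r)) r :=
  hasDerivAt_liouville h p hr0 (hasDerivAt_horU h hR hp hpR hr) (hasDerivAt_horU₁ h hR hp hpR hr)
    (horU_ode h hR hp hpR hr)

/-- The local solution as an `IsSol2` on `(r₊, r₊ + ρ(R)/2)`. [folklore] -/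
theorem isSol2_radG_mul_horU :
    IsSol2 (radQ M a m p) (fun s ↦ radG M a m p.1 s * horU M a m p s)
      (fun s ↦ radG₁ M a m p.1 s * horU M a m p s + radG M a m p.1 s * horU₁ M a m R p s)
      (Ioo (Kerr.rPlus M a) (Kerr.rPlus M a + horRho M a R / 2)) := by
  refine ⟨fun r hr ↦ (hasDerivAt_radG_mul_horU h hR hp hpR hr.1 ?_).1,
    fun r hr ↦ (hasDerivAt_radG_mul_horU h hR hp hpR hr.1 ?_).2⟩ <;>
  · rw [abs_lt]; constructor <;> linarith [hr.1, hr.2, horRho_pos h hR]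

end

end HorizonSolution

/-! ### The global horizon-regular solution `y(r; p)` on `(r₊, ∞)` -/

section Global

variable (M a : ℝ) (m : ℤ)

/-- A box size adapted to `p`. [folklore] -/
def radR (p : ℂ × ℂ × ℂ) : ℝ := ‖p.1‖ + ‖p.2.1‖ + ‖p.2.2‖

/-- The anchoring radius `r₊ + ρ(radR p)/4`. [folklore] -/
def radT (p : ℂ × ℂ × ℂ) : ℝ := Kerr.rPlus M a + horRho M a (radR p) / 4

variable {M a m}

/-- `radR p ≥ 0`. [folklore] -/
theorem radR_nonneg (p : ℂ × ℂ × ℂ) : 0 ≤ radR p := by unfold radR; positivity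

/-- `p` lies in the closed box of size `radR p`. [folklore] -/
theorem mem_horBoxClosed_radR (p : ℂ × ℂ × ℂ) : p ∈ horBoxClosed (radR p) := by
  refine ⟨?_, ?_, ?_⟩ <;> · unfold radR; linarith [norm_nonneg p.1, norm_nonneg p.2.1, norm_nonneg p.2.2]

/-- `Q(·; p)` is continuous on `(r₊, ∞)`. [folklore] -/
theorem continuousOn_radQ (h : |a| ≤ M) (p : ℂ × ℂ × ℂ) : ContinuousOn (radQ M a m p) (Ioi (Kerr.rPlus M a)) := by
  have hc : ContinuousOn (fun r ↦ ∑ i : Fin 5, radMon i p * radH M a m i r) (Ioi (Kerr.rPlus M a)) :=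
    continuousOn_finsetSum _ fun i _ ↦ continuousOn_const.mul (continuousOn_radH h i)
  exact hc.congr fun r hr ↦ radQ_eq_sum h p hr

/-- Existence of a solution pair on `(r₀, ∞)` with prescribed data (repackaged). [folklore] -/
theorem exists_pair_isSol2_Ioi {Q : ℝ → ℂ} {r₀ : ℝ} (hQ : ContinuousOn Q (Ioi r₀)) (t₀ : ℝ) (c₀ c₁ : ℂ) :
    ∃ yy : (ℝ → ℂ) × (ℝ → ℂ), IsSol2 Q yy.1 yy.2 (Ioi r₀) ∧ yy.1 t₀ = c₀ ∧ yy.2 t₀ = c₁ := by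
  obtain ⟨y, y', hy⟩ := exists_isSol2_Ioi hQ t₀ c₀ c₁
  exact ⟨(y, y'), hy⟩

variable (M a m) in
/-- The pair `(y, y')` of the global horizon-regular solution: the solution of `y'' = Q(·; p) y` on
`(r₊, ∞)` whose data at `radT p` are those of `G u` (junk `0` if `|a| > M`). [folklore] -/
def radYPair (p : ℂ × ℂ × ℂ) : (ℝ → ℂ) × (ℝ → ℂ) :=
  if h : |a| ≤ M then
    (exists_pair_isSol2_Ioi (continuousOn_radQ (m := m) h p) (radT M a p)
      (radG M a m p.1 (radT M a p) * horU M a m p (radT M a p))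
      (radG₁ M a m p.1 (radT M a p) * horU M a m p (radT M a p) +
        radG M a m p.1 (radT M a p) * horU₁ M a m (radR p) p (radT M a p))).choose
  else 0

variable (M a m) in
/-- **The horizon-regular solution** `y(r; p)` of `y'' = Q(·; p) y` on `(r₊, ∞)`.
[cite: ShlapentokhRothman2014KleinGordon, §2 Def. 2.1] -/
def radY (p : ℂ × ℂ × ℂ) (r : ℝ) : ℂ := (radYPair M a m p).1 r

variable (M a m) in
/-- Its derivative `y'(r; p)`. [folklore] -/
def radY₁ (p : ℂ × ℂ × ℂ) (r : ℝ) : ℂ := (radYPair M a m p).2 r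

/-- The defining property of `(y, y')`. [folklore] -/
theorem radY_spec (h : |a| ≤ M) (p : ℂ × ℂ × ℂ) :
    IsSol2 (radQ M a m p) (radY M a m p) (radY₁ M a m p) (Ioi (Kerr.rPlus M a)) ∧
      radY M a m p (radT M a p) = radG M a m p.1 (radT M a p) * horU M a m p (radT M a p) ∧
      radY₁ M a m p (radT M a p) = radG₁ M a m p.1 (radT M a p) * horU M a m p (radT M a p) +
        radG M a m p.1 (radT M a p) * horU₁ M a m (radR p) p (radT M a p) := by
  have hs := (exists_pair_isSol2_Ioi (continuousOn_radQ (m := m) h p) (radT M a p)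
      (radG M a m p.1 (radT M a p) * horU M a m p (radT M a p))
      (radG₁ M a m p.1 (radT M a p) * horU M a m p (radT M a p) +
        radG M a m p.1 (radT M a p) * horU₁ M a m (radR p) p (radT M a p))).choose_spec
  have e1 : radY M a m p = (radYPair M a m p).1 := rfl
  have e2 : radY₁ M a m p = (radYPair M a m p).2 := rfl
  rw [e1, e2, radYPair, dif_pos h]
  exact hs

/-- **`y(·; p)` solves `y'' = Q(·; p) y` on `(r₊, ∞)`.** [folklore] -/
theorem isSol2_radY (h : |a| ≤ M) (p : ℂ × ℂ × ℂ) :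
    IsSol2 (radQ M a m p) (radY M a m p) (radY₁ M a m p) (Ioi (Kerr.rPlus M a)) :=
  (radY_spec h p).1

/-- Local uniqueness on `(r₊, r₊ + c)`, from `LinearSecondOrder.eqOn_of_solution_Ioo`. [folklore] -/
theorem eqOn_Ioo_of_isSol2 (h : |a| ≤ M) {p : ℂ × ℂ × ℂ} {c t₀ : ℝ} {y y' z z' : ℝ → ℂ}
    (hy : IsSol2 (radQ M a m p) y y' (Ioo (Kerr.rPlus M a) (Kerr.rPlus M a + c)))
    (hz : IsSol2 (radQ M a m p) z z' (Ioo (Kerr.rPlus M a) (Kerr.rPlus M a + c)))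
    (ht₀ : t₀ ∈ Ioo (Kerr.rPlus M a) (Kerr.rPlus M a + c)) (h0 : y t₀ = z t₀) (h1 : y' t₀ = z' t₀) :
    EqOn y z (Ioo (Kerr.rPlus M a) (Kerr.rPlus M a + c)) ∧ EqOn y' z' (Ioo (Kerr.rPlus M a) (Kerr.rPlus M a + c)) :=
  eqOn_of_solution_Ioo (p := fun _ ↦ (0 : ℂ)) continuousOn_const
    ((continuousOn_radQ (m := m) h p).mono fun _ hr ↦ hr.1) ht₀ hy.linForm hz.linForm h0 h1

/-- **Near the horizon `y = G u`**: for `p ∈ horGood ∩ horBoxClosed R` and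
`r ∈ (r₊, r₊ + ρ(R)/2)`, `y(r; p) = G(r) u(r; p)` and `y'(r; p) = G₁ u + G u₁`.
[cite: ShlapentokhRothman2014KleinGordon, §2 Def. 2.1] -/
theorem radY_eq_loc (h : Kerr.IsSubextremal M a) {R : ℝ} (hR : 0 ≤ R) {p : ℂ × ℂ × ℂ} (hp : p ∈ horGood M a)
    (hpR : p ∈ horBoxClosed R) {r : ℝ} (hr : r ∈ Ioo (Kerr.rPlus M a) (Kerr.rPlus M a + horRho M a R / 2)) :
    radY M a m p r = radG M a m p.1 r * horU M a m p r ∧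
      radY₁ M a m p r = radG₁ M a m p.1 r * horU M a m p r + radG M a m p.1 r * horU₁ M a m R p r := by
  set R₀ := radR p with hR₀_def
  have hR₀ : 0 ≤ R₀ := radR_nonneg p
  have hpR₀ : p ∈ horBoxClosed R₀ := mem_horBoxClosed_radR p
  have hρ := horRho_pos h hR
  have hρ₀ := horRho_pos h hR₀
  obtain ⟨hsol, hd0, hd1⟩ := radY_spec (m := m) h.le p
  -- Step 1: agreement on `I₀ = (r₊, r₊ + ρ₀/2)` with the `R₀`-local solution
  have hT : radT M a p ∈ Ioo (Kerr.rPlus M a) (Kerr.rPlus M a + horRho M a R₀ / 2) := by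
    simp only [radT, mem_Ioo, ← hR₀_def]; constructor <;> linarith
  have step1 := eqOn_Ioo_of_isSol2 h.le (hsol.mono fun s hs ↦ hs.1) (isSol2_radG_mul_horU h hR₀ hp hpR₀) hT
    hd0 hd1
  -- Step 2: the common point `t₁`
  set t₁ : ℝ := Kerr.rPlus M a + min (horRho M a R) (horRho M a R₀) / 4 with ht₁
  have hmin : 0 < min (horRho M a R) (horRho M a R₀) := lt_min hρ hρ₀
  have ht₁I : t₁ ∈ Ioo (Kerr.rPlus M a) (Kerr.rPlus M a + horRho M a R / 2) := by
    simp only [ht₁, mem_Ioo]; constructor <;> linarith [min_le_left (horRho M a R) (horRho M a R₀)]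
  have ht₁I₀ : t₁ ∈ Ioo (Kerr.rPlus M a) (Kerr.rPlus M a + horRho M a R₀ / 2) := by
    simp only [ht₁, mem_Ioo]; constructor <;> linarith [min_le_right (horRho M a R) (horRho M a R₀)]
  have habs : ∀ {ρ' : ℝ}, t₁ ∈ Ioo (Kerr.rPlus M a) (Kerr.rPlus M a + ρ' / 2) → |t₁ - Kerr.rPlus M a| < ρ' / 2 := by
    intro ρ' ht; rw [abs_lt]; constructor <;> linarith [ht.1, ht.2]
  have hu₁ : horU₁ M a m R₀ p t₁ = horU₁ M a m R p t₁ :=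
    (hasDerivAt_horU h hR₀ hp hpR₀ (habs ht₁I₀)).unique (hasDerivAt_horU h hR hp hpR (habs ht₁I))
  have e0 : radY M a m p t₁ = radG M a m p.1 t₁ * horU M a m p t₁ := step1.1 ht₁I₀
  have e1 : radY₁ M a m p t₁ = radG₁ M a m p.1 t₁ * horU M a m p t₁ + radG M a m p.1 t₁ * horU₁ M a m R p t₁ := by
    have h2 := step1.2 ht₁I₀
    simp only at h2
    rw [h2, hu₁]
  -- Step 3: uniqueness on `I = (r₊, r₊ + ρ/2)` from `t₁`
  have step3 := eqOn_Ioo_of_isSol2 h.le (hsol.mono fun s hs ↦ hs.1) (isSol2_radG_mul_horU h hR hp hpR) ht₁I e0 e1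
  exact ⟨step3.1 hr, step3.2 hr⟩

end Global

/-! ### Horizon values -/

section HorizonValues

variable {M a : ℝ} {m : ℤ}

/-- Conjugation symmetry of `Q`: `conj Q(r; ω, Λ, σ) = Q(r; ω̄, Λ̄, σ̄)`. [folklore] -/
theorem conj_radQ (p : ℂ × ℂ × ℂ) (r : ℝ) :
    conj (radQ M a m p r) = radQ M a m (conj p.1, conj p.2.1, conj p.2.2) r := by
  simp only [radQ, radPot, map_div₀, map_sub, map_add, map_mul, map_neg, map_pow, Complex.conj_ofReal]

/-- For real parameters `Q` is real. [folklore] -/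
theorem im_radQ_ofReal (w Λ σ : ℝ) (r : ℝ) : (radQ M a m ((w : ℂ), (Λ : ℂ), (σ : ℂ)) r).im = 0 := by
  have hc := conj_radQ (M := M) (a := a) (m := m) ((w : ℂ), (Λ : ℂ), (σ : ℂ)) r
  simp only [Complex.conj_ofReal] at hc
  exact Complex.conj_eq_iff_im.1 hc

/-- For real `ω`, `G Ḡ = Δ` on `(r₊, ∞)`. [folklore] -/
theorem radG_mul_conj (h : |a| ≤ M) {w : ℂ} (hw : w.im = 0) {r : ℝ} (hr : Kerr.rPlus M a < r) :
    radG M a m w r * conj (radG M a m w r) = (Kerr.delta M a r : ℂ) := by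
  rw [Complex.mul_conj, Complex.normSq_eq_norm_sq, norm_radG_sq h hw hr]

/-- `Δ f = (r − M) − iK`. [folklore] -/
theorem delta_mul_radLogG (h : |a| ≤ M) (w : ℂ) {r : ℝ} (hr : Kerr.rPlus M a < r) :
    (Kerr.delta M a r : ℂ) * radLogG M a m w r = ((r - M : ℝ) : ℂ) - Complex.I * radK M a m w r := by
  have hΔ : (Kerr.delta M a r : ℂ) ≠ 0 := by exact_mod_cast (Kerr.delta_pos h hr).ne'
  have h2 : ((2 * Kerr.delta M a r : ℝ) : ℂ) ≠ 0 := by push_cast; exact mul_ne_zero two_ne_zero hΔ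
  simp only [radLogG]
  push_cast at h2 ⊢
  field_simp

/-- `d/dt im (y₁ ȳ) = im Q · ‖y‖²` along a solution of `y'' = Q y`. [folklore] -/
theorem hasDerivAt_im_mul_conj {Q : ℝ → ℂ} {y y₁ : ℝ → ℂ} {s : Set ℝ} (hy : IsSol2 Q y y₁ s) {t : ℝ} (ht : t ∈ s) :
    HasDerivAt (fun r ↦ (y₁ r * conj (y r)).im) ((Q t).im * ‖y t‖ ^ 2) t := by
  have h1 := hy.hasDerivAt t ht
  have h2 := hy.hasDerivAt_deriv t ht
  have hc : HasDerivAt (fun r ↦ conj (y r)) (conj (y₁ t)) t := by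
    simpa only [starRingEnd_apply] using h1.star
  have hm := h2.mul hc
  have him := Complex.imCLM.hasFDerivAt.comp_hasDerivAt t hm
  have him' : HasDerivAt (fun r ↦ (y₁ r * conj (y r)).im)
      ((Q t * y t * conj (y t) + y₁ t * conj (y₁ t)).im) t := by
    simpa [Function.comp_def] using him
  refine him'.congr_deriv ?_
  rw [mul_assoc, Complex.mul_conj, Complex.mul_conj, Complex.normSq_eq_norm_sq, Complex.normSq_eq_norm_sq]
  simp [Complex.add_im, Complex.mul_im, -Complex.ofReal_pow]

/-- **The horizon current.** For real parameters `(ω, Λ, σ)` and every `r > r₊`,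
`im (y'(r) ȳ(r)) = am − 2Mωr₊` (`= β`): the current is constant (`Q` real) and its limit at
`r₊` is read off from `y = G u`, `u(r₊) = 1`. This is the microlocal energy current at the
horizon of SR §3 (`Q_T(r₊)`-identity). [cite: ShlapentokhRothman2014KleinGordon, §3 Lemma 3.2] -/
theorem im_radY₁_mul_conj (h : Kerr.IsSubextremal M a) (w Λ σ : ℝ) {r : ℝ} (hr : Kerr.rPlus M a < r) :
    (radY₁ M a m ((w : ℂ), (Λ : ℂ), (σ : ℂ)) r * conj (radY M a m ((w : ℂ), (Λ : ℂ), (σ : ℂ)) r)).im =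
      a * m - 2 * M * w * Kerr.rPlus M a := by
  set p : ℂ × ℂ × ℂ := ((w : ℂ), (Λ : ℂ), (σ : ℂ)) with hp_def
  have hp : p ∈ horGood M a := mem_horGood_of_im_nonneg h (by simp [p])
  set R := radR p with hR_def
  have hR : 0 ≤ R := radR_nonneg p
  have hpR : p ∈ horBoxClosed R := mem_horBoxClosed_radR p
  have hρ := horRho_pos h hR
  have hsol := isSol2_radY (m := m) h.le p
  set g : ℝ → ℝ := fun s ↦ (radY₁ M a m p s * conj (radY M a m p s)).im with hg
  -- (1) `g` has zero derivative on `(r₊, ∞)`, hence is constant there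
  have hder : ∀ s ∈ Ioi (Kerr.rPlus M a), HasDerivAt g 0 s := by
    intro s hs
    have := hasDerivAt_im_mul_conj hsol hs
    rw [im_radQ_ofReal, zero_mul] at this
    exact this
  have hconst : ∀ s ∈ Ioi (Kerr.rPlus M a), g s = g r := fun s hs ↦
    isOpen_Ioi.is_const_of_deriv_eq_zero isPreconnected_Ioi
      (fun x hx ↦ (hder x hx).differentiableAt.differentiableWithinAt) (fun x hx ↦ (hder x hx).deriv) hs hr
  -- (2) near `r₊`, `g` is the explicit continuous expression `e`
  set e : ℝ → ℝ := fun s ↦ ((((s - M : ℝ) : ℂ) - Complex.I * radK M a m p.1 s) * ((‖horU M a m p s‖ ^ 2 : ℝ) : ℂ) +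
    (Kerr.delta M a s : ℂ) * (horU₁ M a m R p s * conj (horU M a m p s))).im with he
  have hloc : ∀ s ∈ Ioo (Kerr.rPlus M a) (Kerr.rPlus M a + horRho M a R / 2), g s = e s := by
    intro s hs
    obtain ⟨h0, h1⟩ := radY_eq_loc (m := m) h hR hp hpR hs
    have e1 := radG_mul_conj (m := m) h.le (w := p.1) (by simp [p]) hs.1
    have e2 := delta_mul_radLogG (m := m) h.le p.1 hs.1
    have e3 : horU M a m p s * conj (horU M a m p s) = ((‖horU M a m p s‖ ^ 2 : ℝ) : ℂ) := by
      rw [Complex.mul_conj, Complex.normSq_eq_norm_sq]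
    simp only [hg, he, h0, h1, radG₁, map_mul]
    congr 1
    linear_combination (radLogG M a m p.1 s * horU M a m p s * conj (horU M a m p s) +
      horU₁ M a m R p s * conj (horU M a m p s)) * e1 +
      horU M a m p s * conj (horU M a m p s) * e2 + ((((s - M : ℝ) : ℂ) - Complex.I * radK M a m p.1 s)) * e3
  -- (3) `e` is continuous at `r₊` with value `am − 2Mωr₊`
  obtain ⟨hcu, hcu₁⟩ := continuousAt_horU_rPlus (m := m) h hR hp hpR
  have hcK : Continuous fun s : ℝ ↦ radK M a m p.1 s := by unfold radK; fun_prop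
  have hcΔ : Continuous fun s : ℝ ↦ (Kerr.delta M a s : ℂ) := by unfold Kerr.delta; fun_prop
  have hce : ContinuousAt e (Kerr.rPlus M a) := by
    simp only [he]
    have hA : ContinuousAt (fun s : ℝ ↦ (((s - M : ℝ) : ℂ) - Complex.I * radK M a m p.1 s) *
        ((‖horU M a m p s‖ ^ 2 : ℝ) : ℂ)) (Kerr.rPlus M a) :=
      ((by fun_prop : Continuous fun s : ℝ ↦ ((s - M : ℝ) : ℂ) - Complex.I * radK M a m p.1 s).continuousAt).mul
        (Complex.continuous_ofReal.continuousAt.comp ((hcu.norm).pow 2))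
    have hB : ContinuousAt (fun s : ℝ ↦ (Kerr.delta M a s : ℂ) * (horU₁ M a m R p s * conj (horU M a m p s)))
        (Kerr.rPlus M a) :=
      hcΔ.continuousAt.mul (hcu₁.mul (Complex.continuous_conj.continuousAt.comp hcu))
    exact Complex.continuous_im.continuousAt.comp (hA.add hB)
  have he0 : e (Kerr.rPlus M a) = a * m - 2 * M * w * Kerr.rPlus M a := by
    simp only [he, horU_rPlus h, Kerr.delta_rPlus h.le, norm_one, one_pow, Complex.ofReal_one, mul_one,
      Complex.ofReal_zero, zero_mul, add_zero]
    simp [radK, p, Complex.mul_im, Complex.mul_re]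
  -- (4) conclude by uniqueness of limits from the right at `r₊`
  have hlim1 : Tendsto e (𝓝[>] Kerr.rPlus M a) (𝓝 (e (Kerr.rPlus M a))) := hce.continuousWithinAt
  have hlim2 : Tendsto e (𝓝[>] Kerr.rPlus M a) (𝓝 (g r)) := by
    refine (tendsto_const_nhds (x := g r)).congr' ?_
    filter_upwards [Ioo_mem_nhdsGT (show Kerr.rPlus M a < Kerr.rPlus M a + horRho M a R / 2 by linarith)]
      with s hs
    rw [← hloc s hs, hconst s hs.1]
  have := tendsto_nhds_unique hlim1 hlim2
  show g r = _
  rw [← this, he0]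

/-- **The Wronskian of two horizon-regular solutions with the same real frequency vanishes at the
horizon**: `W(y(·; p), y(·; q))(r) → 0` as `r → r₊⁺` when `p.1 = q.1` is real
(`W = G² (u_p u_q' − u_p' u_q)`, `‖G‖² = Δ → 0`). [folklore] -/
theorem tendsto_wronskian_radY (h : Kerr.IsSubextremal M a) {p q : ℂ × ℂ × ℂ} (hpq : p.1 = q.1) (hw : p.1.im = 0) :
    Tendsto (fun r ↦ wronskian (radY M a m p) (radY₁ M a m p) (radY M a m q) (radY₁ M a m q) r)
      (𝓝[>] Kerr.rPlus M a) (𝓝 0) := by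
  have hp : p ∈ horGood M a := mem_horGood_of_im_nonneg h hw.ge
  have hq : q ∈ horGood M a := mem_horGood_of_im_nonneg h (by rw [← hpq]; exact hw.ge)
  set R := max (radR p) (radR q) with hR_def
  have hR : 0 ≤ R := (radR_nonneg p).trans (le_max_left _ _)
  have hbox : ∀ {p' : ℂ × ℂ × ℂ}, radR p' ≤ R → p' ∈ horBoxClosed R := fun {p'} hp' ↦
    ⟨(mem_horBoxClosed_radR p').1.trans hp', (mem_horBoxClosed_radR p').2.1.trans hp',
      (mem_horBoxClosed_radR p').2.2.trans hp'⟩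
  have hpR : p ∈ horBoxClosed R := hbox (le_max_left _ _)
  have hqR : q ∈ horBoxClosed R := hbox (le_max_right _ _)
  have hρ := horRho_pos h hR
  -- the explicit expression near `r₊`
  set e : ℝ → ℂ := fun s ↦ radG M a m p.1 s ^ 2 *
    (horU M a m p s * horU₁ M a m R q s - horU₁ M a m R p s * horU M a m q s) with he
  have hloc : ∀ s ∈ Ioo (Kerr.rPlus M a) (Kerr.rPlus M a + horRho M a R / 2),
      wronskian (radY M a m p) (radY₁ M a m p) (radY M a m q) (radY₁ M a m q) s = e s := by
    intro s hs
    obtain ⟨hp0, hp1⟩ := radY_eq_loc (m := m) h hR hp hpR hs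
    obtain ⟨hq0, hq1⟩ := radY_eq_loc (m := m) h hR hq hqR hs
    simp only [wronskian, he, hp0, hp1, hq0, hq1, radG₁, ← hpq]
    ring
  -- `‖e s‖ ≤ Δ(s) · ‖…‖ → 0`
  obtain ⟨hcu, hcu₁⟩ := continuousAt_horU_rPlus (m := m) h hR hp hpR
  obtain ⟨hcv, hcv₁⟩ := continuousAt_horU_rPlus (m := m) h hR hq hqR
  have hcΔ : Continuous fun s : ℝ ↦ Kerr.delta M a s := by unfold Kerr.delta; fun_prop
  set b : ℝ → ℝ := fun s ↦ Kerr.delta M a s *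
    ‖horU M a m p s * horU₁ M a m R q s - horU₁ M a m R p s * horU M a m q s‖ with hb
  have hcb : ContinuousAt b (Kerr.rPlus M a) :=
    hcΔ.continuousAt.mul ((hcu.mul hcv₁).sub (hcu₁.mul hcv)).norm
  have hb0 : b (Kerr.rPlus M a) = 0 := by simp [hb, Kerr.delta_rPlus h.le]
  have hblim : Tendsto b (𝓝[>] Kerr.rPlus M a) (𝓝 0) := hb0 ▸ hcb.continuousWithinAt
  have hbound : ∀ᶠ s in 𝓝[>] Kerr.rPlus M a,
      ‖wronskian (radY M a m p) (radY₁ M a m p) (radY M a m q) (radY₁ M a m q) s‖ ≤ b s := by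
    filter_upwards [Ioo_mem_nhdsGT (show Kerr.rPlus M a < Kerr.rPlus M a + horRho M a R / 2 by linarith)]
      with s hs
    rw [hloc s hs, he, norm_mul, norm_pow, norm_radG_sq h.le hw hs.1]
  refine squeeze_zero_norm' hbound hblim

/-- **`y(r; p) → 0` as `r → r₊⁺`** for real `ω` (`‖y‖ = √Δ ‖u‖`). [folklore] -/
theorem tendsto_radY_rPlus (h : Kerr.IsSubextremal M a) {p : ℂ × ℂ × ℂ} (hw : p.1.im = 0) :
    Tendsto (radY M a m p) (𝓝[>] Kerr.rPlus M a) (𝓝 0) := by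
  have hp : p ∈ horGood M a := mem_horGood_of_im_nonneg h hw.ge
  set R := radR p
  have hR : 0 ≤ R := radR_nonneg p
  have hpR : p ∈ horBoxClosed R := mem_horBoxClosed_radR p
  have hρ := horRho_pos h hR
  obtain ⟨hcu, -⟩ := continuousAt_horU_rPlus (m := m) h hR hp hpR
  have hcΔ : Continuous fun s : ℝ ↦ Real.sqrt (Kerr.delta M a s) := by unfold Kerr.delta; fun_prop
  set b : ℝ → ℝ := fun s ↦ Real.sqrt (Kerr.delta M a s) * ‖horU M a m p s‖ with hb
  have hcb : ContinuousAt b (Kerr.rPlus M a) := hcΔ.continuousAt.mul hcu.norm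
  have hb0 : b (Kerr.rPlus M a) = 0 := by simp [hb, Kerr.delta_rPlus h.le]
  have hblim : Tendsto b (𝓝[>] Kerr.rPlus M a) (𝓝 0) := hb0 ▸ hcb.continuousWithinAt
  have hbound : ∀ᶠ s in 𝓝[>] Kerr.rPlus M a, ‖radY M a m p s‖ ≤ b s := by
    filter_upwards [Ioo_mem_nhdsGT (show Kerr.rPlus M a < Kerr.rPlus M a + horRho M a R / 2 by linarith)]
      with s hs
    rw [(radY_eq_loc (m := m) h hR hp hpR hs).1, norm_mul, radG, norm_mul, norm_radPhase_of_im_eq_zero hw,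
      mul_one, Complex.norm_real, Real.norm_eq_abs, abs_of_nonneg (Real.sqrt_nonneg _)]
  exact squeeze_zero_norm' hbound hblim

end HorizonValues

end Literature.Barriers.FinalStateConjecture
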